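import Mathlib
import Literature.LinearAlgebra.Matrix.HyperpowerIteration
import HarnessLib

/-!
# Newton iterations for the matrix sign function, the square root and the polar factor

[Golub–Van Loan, *Matrix Computations*, 4th ed., §9.4 "The sign, square root, and log of a
matrix"].  §9.4.1: `sign(A) = X diag(−I_{m₁}, I_{m₂}) X⁻¹` for `A` with no purely imaginary
eigenvalue; the *Newton sign iteration*

  `S₀ = A`,  `S_{k+1} = (S_k + S_k⁻¹)/2`                                          (9.4.1)

satisfies, with `S = sign(A)` (so `S² = I` and `S S_k = S_k S`),

  `S_{k+1} − S = ½ S_k⁻¹ (S_k − S)²`,   `S_{k+1} + S = ½ S_k⁻¹ (S_k + S)²`,     (9.4.2), (9.4.3)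

hence `G_k = (S_k − S)(S_k + S)⁻¹` (9.4.4) obeys `G_{k+1} = G_k²`, `G_k = G₀^{2^k}`, and
`S_k = S (I + G_k)(I − G_k)⁻¹ → S`; the inverse-free *Newton–Schulz* variant is
`S_{k+1} = ½ S_k (3I − S_k²)` (9.4.5).  §9.4.2: the Newton square-root iteration
`X_{k+1} = (X_k + X_k⁻¹ A)/2`, `X₀ = A` (9.4.7) becomes (9.4.1) under `X_k = A^{1/2} S_k`; the
Newton sign iteration applied to `Ã = [0 A; I 0]` keeps the form `[0 X_k; Y_k 0]` and is the
*Denman–Beavers iteration* `X_{k+1} = (X_k + Y_k⁻¹)/2`, `Y_{k+1} = (Y_k + X_k⁻¹)/2` (9.4.8),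
with `X_k = A Y_k` (9.4.9), i.e. `X_{k+1} = (X_k + A X_k⁻¹)/2`, `Y_{k+1} = (Y_k + A⁻¹ Y_k⁻¹)/2`
(9.4.10), and `sign([0 A; I 0]) = [0 A^{1/2}; A^{−1/2} 0]`.  §9.4.3: the Newton iteration for the
orthogonal polar factor, `X_{k+1} = (X_k + X_k^{−T})/2` (9.4.11), reads
`X_{k+1} = U (P_k + P_k⁻¹)/2` for `X_k = U P_k` (9.4.12): the Newton sign iteration on the
Hermitian polar factor.

This file machine-checks the exact (algebraic) content of §9.4.1–9.4.3 over any field of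
characteristic zero (`ℝ`, `ℂ` in the book), and the convergence statements in the topology of
`Matrix`.  The matrix sign function itself is never needed as an object: throughout, `T` is an
arbitrary matrix with `T² = I` commuting with the iterate — for `T = sign(A)` these are exactly
the two facts the book's argument uses — and Part V says that the Newton iterates converge to
such a `T` as soon as the Cayley transform `G₀ = (A − T)(A + T)⁻¹` is a convergent matrix.  No
definition is introduced; the Newton map is written out as `(2:𝕜)⁻¹ • (S + S⁻¹)`.

* **Part I (one Newton step, any field).** (9.4.2), (9.4.3); `S_{k+1} + T` is nonsingular with
  the explicit inverse `2 (S_k + T)⁻² S_k`; (9.4.4) `G_{k+1} = G_k²`; the Cayley parametrisation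
  `S = T (I + G)(I − G)⁻¹`, `S − T = 2 T G (I − G)⁻¹`, `(I − G)⁻¹ = ½ (S + T) T`, valid for every
  `S` commuting with `T` with `S + T` nonsingular, and `S` nonsingular iff `I + G` is; along
  (9.4.1): `G_k = G₀^{2^k}` and `S_k = T (I + G₀^{2^k})(I − G₀^{2^k})⁻¹`.
* **Part II (Newton–Schulz (9.4.5)).** `½ (S + S (2I − S²)) = ½ S (3I − S²)`, and the residual law
  `I − S_{k+1}² = ¼ (I − S_k²)² (4I − S_k²)` that makes (9.4.5) locally quadratically convergent.
* **Part III (square roots, §9.4.2).** `S_k = F⁻¹ X_k` (`F² = A`, `F` nonsingular) turns (9.4.7)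
  into (9.4.1) started at `S₀ = F`; the inverse of `[0 X; Y 0]` and one Newton step on it, i.e.
  (9.4.8); the Newton iterates of `[0 A; I 0]` are `[0 X_k; Y_k 0]`; the invariant (9.4.9) and the
  decoupled recursions (9.4.10); P9.4.5: `M_{k+1} = ¼ (M_k + M_k⁻¹ + 2I)` for `M_k = X_k Y_k`; and
  the algebra of `sign(Ã) = J := [0 F; F⁻¹ 0]`: `J² = I`, `Ã = J·diag(F, F) = diag(F, F)·J`.
* **Part IV (polar factor, §9.4.3).** For `X = U P`, `UᴴU = I`, `P` Hermitian nonsingular: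
  `X⁻ᴴ = U P⁻¹` and (9.4.12); along (9.4.11), `X_k = U P_k` with `P_k` the (Hermitian) Newton sign
  iterates of `P`, so that `X_k − U = U (P_k − I)`.
* **Part V (convergence, `RCLike` scalars).** If `G₀^j → O` then every `S_k` and `S_k + T` is
  nonsingular — (9.4.1) is well defined with no further hypothesis — and `S_k → T`; over `ℂ` the
  hypothesis is supplied from `ρ(G₀) < 1` (the book's appeal to Lemma 7.3.2).  The scalar facts
  quoted on the way: `Re ½(z + 1/z) = (a/2)(1 + 1/(a²+b²))`, `Im ½(z + 1/z) = (b/2)(1 − 1/(a²+b²))`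
  (so the open half-planes are preserved) and `|λ − sign λ| < |λ + sign λ|` (so `|μ| < 1`; the
  quotient form for `Re λ > 0` is already `Literature.Analysis.Complex.norm_cayley_lt_one`).
  Consequences: (9.4.7) converges to `F`, the Denman–Beavers iterates to `(F, F⁻¹)`, and (9.4.11)
  to the polar factor `U`, whenever the corresponding Cayley transform is convergent.

Remarks on the text.  (i) Before (9.4.2) the book prints "the identity `S² = S`"; what is used
(and holds for `S = sign(A)`) is `S² = I`.  (ii) "If `S_k` is nonsingular then `S_{k+1}` is
nonsingular" is true under the standing hypothesis (no eigenvalue of `S_k` on the imaginary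
axis, which the displayed eigenvalue map preserves: `newton_re_pos`, `newton_re_neg`) but not
literally, since an eigenvalue `±i` of `S_k` is mapped to `0`; here well-definedness comes out
of the Cayley parametrisation instead (`S_k` is nonsingular iff `I + G₀^{2^k}` is, which holds
whenever `G₀` is convergent: `newtonSeq_invariant_of_tendsto`).  (iii) The quadratic-rate
inequality after (9.4.4) is `norm_mul_le` applied to (9.4.2); the scaled iteration (9.4.6),
Theorem 9.4.1 (see `PolarDecompositionGeneral.lean`) and the unitary block diagonalisation of
`[0 A; Aᵀ 0]` (see `JordanWielandtMatrix.lean`) are not treated here.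
-/

namespace Literature.LinearAlgebra.Matrix.MatrixSignIteration

open Filter _root_.Matrix
open scoped _root_.Topology

section Field

variable {𝕜 : Type*} [Field 𝕜] {n : Type*} [Fintype n] [DecidableEq n]

/-! ## Part I(a) — identities needing no division by `2` -/

/-- Over a field, `B⁻¹` commutes with whatever `B` commutes with (`B⁻¹ = 0` if `B` is
singular). [folklore] -/
private theorem commute_inv_right {A B : Matrix n n 𝕜} (h : Commute A B) : Commute A B⁻¹ := by
  by_cases hB : IsUnit B.det
  · have h1 : B⁻¹ * B = 1 := Matrix.nonsing_inv_mul B hB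
    have h2 : B * B⁻¹ = 1 := Matrix.mul_nonsing_inv B hB
    calc A * B⁻¹ = B⁻¹ * B * A * B⁻¹ := by rw [h1, Matrix.one_mul]
      _ = B⁻¹ * (A * B) * B⁻¹ := by rw [Matrix.mul_assoc B⁻¹ B A, ← h.eq]
      _ = B⁻¹ * A := by rw [Matrix.mul_assoc B⁻¹, Matrix.mul_assoc A, h2, Matrix.mul_one]
  · rw [Matrix.nonsing_inv_apply_not_isUnit B hB]
    exact Commute.zero_right A

/-- The Newton map `S ↦ ½ (S + S⁻¹)` of (9.4.1) commutes with whatever `S` commutes with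
("`S S_k = S_k S` since both matrices are rational functions of `A`").
[cite: GolubVanLoan2013, §9.4.1 (9.4.1)] -/
theorem commute_newtonStep {S T : Matrix n n 𝕜} (hc : Commute S T) :
    Commute ((2 : 𝕜)⁻¹ • (S + S⁻¹)) T :=
  (hc.add_left (commute_inv_right hc.symm).symm).smul_left _

/-- The expansion behind (9.4.2): `S⁻¹ (S − T)² = S + S⁻¹ − 2T` for an involution `T`
commuting with the nonsingular `S`. [cite: GolubVanLoan2013, §9.4.1 (9.4.2)] -/
theorem inv_mul_sub_sq {S T : Matrix n n 𝕜} (hT : T * T = 1) (hc : Commute S T)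
    (hS : IsUnit S.det) : S⁻¹ * (S - T) ^ 2 = S + S⁻¹ - (2 : 𝕜) • T := by
  have h1 : S⁻¹ * S = 1 := Matrix.nonsing_inv_mul S hS
  calc S⁻¹ * (S - T) ^ 2 = (S⁻¹ * S - S⁻¹ * T) * (S - T) := by
        rw [sq, ← Matrix.mul_assoc, Matrix.mul_sub S⁻¹ S T]
    _ = S - T - S⁻¹ * (T * S) + S⁻¹ * (T * T) := by rw [h1]; noncomm_ring
    _ = S + S⁻¹ - (2 : 𝕜) • T := by
        rw [hT, Matrix.mul_one, ← hc.eq, ← Matrix.mul_assoc, h1, Matrix.one_mul, two_smul]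
        abel

/-- The expansion behind (9.4.3): `S⁻¹ (S + T)² = S + S⁻¹ + 2T`.
[cite: GolubVanLoan2013, §9.4.1 (9.4.3)] -/
theorem inv_mul_add_sq {S T : Matrix n n 𝕜} (hT : T * T = 1) (hc : Commute S T)
    (hS : IsUnit S.det) : S⁻¹ * (S + T) ^ 2 = S + S⁻¹ + (2 : 𝕜) • T := by
  have h1 : S⁻¹ * S = 1 := Matrix.nonsing_inv_mul S hS
  calc S⁻¹ * (S + T) ^ 2 = (S⁻¹ * S + S⁻¹ * T) * (S + T) := by
        rw [sq, ← Matrix.mul_assoc, Matrix.mul_add S⁻¹ S T]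
    _ = S + T + S⁻¹ * (T * S) + S⁻¹ * (T * T) := by rw [h1]; noncomm_ring
    _ = S + S⁻¹ + (2 : 𝕜) • T := by
        rw [hT, Matrix.mul_one, ← hc.eq, ← Matrix.mul_assoc, h1, Matrix.one_mul, two_smul]
        abel

/-- `I − G = 2 T (S + T)⁻¹` for the Cayley transform `G = (S − T)(S + T)⁻¹` of (9.4.4).
[cite: GolubVanLoan2013, §9.4.1 (9.4.4)] -/
theorem one_sub_cayley {S T : Matrix n n 𝕜} (hST : IsUnit (S + T).det) :
    1 - (S - T) * (S + T)⁻¹ = (2 : 𝕜) • (T * (S + T)⁻¹) := by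
  rw [← Matrix.mul_nonsing_inv _ hST, ← sub_mul, ← smul_mul_assoc, two_smul]
  congr 1
  abel

/-- `I + G = 2 S (S + T)⁻¹` for `G = (S − T)(S + T)⁻¹`. [cite: GolubVanLoan2013, §9.4.1 (9.4.4)] -/
theorem one_add_cayley {S T : Matrix n n 𝕜} (hST : IsUnit (S + T).det) :
    1 + (S - T) * (S + T)⁻¹ = (2 : 𝕜) • (S * (S + T)⁻¹) := by
  rw [← Matrix.mul_nonsing_inv _ hST, ← add_mul, ← smul_mul_assoc, two_smul]
  congr 1
  abel

/-- The one-line derivation of the **Newton–Schulz iteration (9.4.5)**: substituting the Newton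
approximation `S (2I − S²)` for `S⁻¹` in `½ (S + S⁻¹)` gives `½ S (3I − S²)`.
[cite: GolubVanLoan2013, §9.4.1 (9.4.5)] -/
theorem newtonSchulzStep_eq (S : Matrix n n 𝕜) :
    (2 : 𝕜)⁻¹ • (S + S * (2 - S ^ 2)) = (2 : 𝕜)⁻¹ • (S * (3 - S ^ 2)) := by
  congr 1
  noncomm_ring

/-- The anti-diagonal block matrix `[0 X; Y 0]` with nonsingular blocks has inverse
`[0 Y⁻¹; X⁻¹ 0]` (the computation displayed before (9.4.8)).
[cite: GolubVanLoan2013, §9.4.2 (9.4.8)] -/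
theorem fromBlocks_zero_inv {X Y : Matrix n n 𝕜} (hX : IsUnit X.det) (hY : IsUnit Y.det) :
    (fromBlocks 0 X Y 0)⁻¹ = fromBlocks 0 Y⁻¹ X⁻¹ 0 := by
  apply Matrix.inv_eq_right_inv
  rw [Matrix.fromBlocks_multiply]
  simp [Matrix.mul_nonsing_inv _ hX, Matrix.mul_nonsing_inv _ hY]

/-- **(9.4.8)**: one Newton step (9.4.1) on `[0 X; Y 0]` is `[0 (X + Y⁻¹)/2; (Y + X⁻¹)/2 0]`.
[cite: GolubVanLoan2013, §9.4.2 (9.4.8)] -/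
theorem newtonStep_fromBlocks {X Y : Matrix n n 𝕜} (hX : IsUnit X.det) (hY : IsUnit Y.det) :
    (2 : 𝕜)⁻¹ • (fromBlocks 0 X Y 0 + (fromBlocks 0 X Y 0)⁻¹) =
      fromBlocks 0 ((2 : 𝕜)⁻¹ • (X + Y⁻¹)) ((2 : 𝕜)⁻¹ • (Y + X⁻¹)) 0 := by
  rw [fromBlocks_zero_inv hX hY, Matrix.fromBlocks_add, Matrix.fromBlocks_smul, add_zero,
    smul_zero]

/-- **P9.4.5**: along the Denman–Beavers iteration (9.4.8) the products `M_k = X_k Y_k` obey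
`M_{k+1} = ¼ (M_k + M_k⁻¹ + 2I)` — no commutativity is needed.
[cite: GolubVanLoan2013, §9.4 P9.4.5] -/
theorem denmanBeaversStep_mul {X Y : Matrix n n 𝕜} (hX : IsUnit X.det) (hY : IsUnit Y.det) :
    (2 : 𝕜)⁻¹ • (X + Y⁻¹) * ((2 : 𝕜)⁻¹ • (Y + X⁻¹)) =
      ((2 : 𝕜)⁻¹ * (2 : 𝕜)⁻¹) • (X * Y + (X * Y)⁻¹ + 2) := by
  rw [smul_mul_smul_comm, Matrix.mul_inv_rev, add_mul, mul_add, mul_add,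
    Matrix.mul_nonsing_inv _ hX, Matrix.nonsing_inv_mul _ hY]
  congr 1
  rw [show (2 : Matrix n n 𝕜) = 1 + 1 from one_add_one_eq_two.symm]
  abel

/-- **(9.4.9)** ("another induction argument", P9.4.4): the Denman–Beavers iterates started at
`X₀ = A`, `Y₀ = I` satisfy `X_k = A Y_k`, and `A` commutes with `Y_k`.
[cite: GolubVanLoan2013, §9.4.2 (9.4.9)] -/
theorem denmanBeavers_invariant {A : Matrix n n 𝕜} {X Y : ℕ → Matrix n n 𝕜} (hA : IsUnit A.det)
    (hX0 : X 0 = A) (hY0 : Y 0 = 1) (hX : ∀ k, X (k + 1) = (2 : 𝕜)⁻¹ • (X k + (Y k)⁻¹))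
    (hY : ∀ k, Y (k + 1) = (2 : 𝕜)⁻¹ • (Y k + (X k)⁻¹)) (k : ℕ) :
    X k = A * Y k ∧ Commute A (Y k) := by
  induction k with
  | zero => rw [hX0, hY0, Matrix.mul_one]; exact ⟨rfl, Commute.one_right A⟩
  | succ k ih =>
    obtain ⟨hk, hck⟩ := ih
    have hXinv : A * (X k)⁻¹ = (Y k)⁻¹ := by
      rw [hk, Matrix.mul_inv_rev, ← Matrix.mul_assoc, (commute_inv_right hck).eq,
        Matrix.mul_assoc, Matrix.mul_nonsing_inv _ hA, Matrix.mul_one]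
    refine ⟨?_, ?_⟩
    · rw [hX, hY, Matrix.mul_smul, Matrix.mul_add, ← hk, hXinv]
    · rw [hY]
      have hcX : Commute A (X k) := by rw [hk]; exact (Commute.refl A).mul_right hck
      exact (hck.add_right (commute_inv_right hcX)).smul_right _

/-- **(9.4.10)**, first half: `X_{k+1} = (X_k + A X_k⁻¹)/2` along the Denman–Beavers iteration.
[cite: GolubVanLoan2013, §9.4.2 (9.4.10)] -/
theorem denmanBeavers_fst {A : Matrix n n 𝕜} {X Y : ℕ → Matrix n n 𝕜} (hA : IsUnit A.det)
    (hX0 : X 0 = A) (hY0 : Y 0 = 1) (hX : ∀ k, X (k + 1) = (2 : 𝕜)⁻¹ • (X k + (Y k)⁻¹))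
    (hY : ∀ k, Y (k + 1) = (2 : 𝕜)⁻¹ • (Y k + (X k)⁻¹)) (k : ℕ) :
    X (k + 1) = (2 : 𝕜)⁻¹ • (X k + A * (X k)⁻¹) := by
  obtain ⟨hk, hck⟩ := denmanBeavers_invariant hA hX0 hY0 hX hY k
  rw [hX, hk, Matrix.mul_inv_rev, ← Matrix.mul_assoc, (commute_inv_right hck).eq,
    Matrix.mul_assoc, Matrix.mul_nonsing_inv _ hA, Matrix.mul_one]

/-- **(9.4.10)**, second half: `Y_{k+1} = (Y_k + A⁻¹ Y_k⁻¹)/2` along the Denman–Beavers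
iteration. [cite: GolubVanLoan2013, §9.4.2 (9.4.10)] -/
theorem denmanBeavers_snd {A : Matrix n n 𝕜} {X Y : ℕ → Matrix n n 𝕜} (hA : IsUnit A.det)
    (hX0 : X 0 = A) (hY0 : Y 0 = 1) (hX : ∀ k, X (k + 1) = (2 : 𝕜)⁻¹ • (X k + (Y k)⁻¹))
    (hY : ∀ k, Y (k + 1) = (2 : 𝕜)⁻¹ • (Y k + (X k)⁻¹)) (k : ℕ) :
    Y (k + 1) = (2 : 𝕜)⁻¹ • (Y k + A⁻¹ * (Y k)⁻¹) := by
  obtain ⟨hk, hck⟩ := denmanBeavers_invariant hA hX0 hY0 hX hY k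
  rw [hY, hk, Matrix.mul_inv_rev,
    (commute_inv_right (commute_inv_right hck).symm).eq]

/-- The Newton sign iterates of `Ã = [0 A; I 0]` are the block matrices `[0 X_k; Y_k 0]` built
from the Denman–Beavers iterates ("we show by induction that `S̃_k` has the form …").
[cite: GolubVanLoan2013, §9.4.2 (9.4.8)] -/
theorem newtonSeq_fromBlocks {A : Matrix n n 𝕜} {X Y : ℕ → Matrix n n 𝕜}
    {W : ℕ → Matrix (n ⊕ n) (n ⊕ n) 𝕜} (hA : IsUnit A.det) (hX0 : X 0 = A) (hY0 : Y 0 = 1)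
    (hX : ∀ k, X (k + 1) = (2 : 𝕜)⁻¹ • (X k + (Y k)⁻¹))
    (hY : ∀ k, Y (k + 1) = (2 : 𝕜)⁻¹ • (Y k + (X k)⁻¹)) (hYu : ∀ k, IsUnit (Y k).det)
    (hW0 : W 0 = fromBlocks 0 A 1 0) (hW : ∀ k, W (k + 1) = (2 : 𝕜)⁻¹ • (W k + (W k)⁻¹))
    (k : ℕ) : W k = fromBlocks 0 (X k) (Y k) 0 := by
  induction k with
  | zero => rw [hW0, hX0, hY0]
  | succ k ih =>
    have hXu : IsUnit (X k).det := by
      rw [(denmanBeavers_invariant hA hX0 hY0 hX hY k).1, Matrix.det_mul]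
      exact hA.mul (hYu k)
    rw [hW, ih, newtonStep_fromBlocks hXu (hYu k), hX, hY]

/-- The algebra behind `sign([0 A; I 0]) = [0 F; F⁻¹ 0]` (`F = A^{1/2}` nonsingular): the block
matrix `J = [0 F; F⁻¹ 0]` is an involution, `J² = I`. [cite: GolubVanLoan2013, §9.4.2 (9.4.10)] -/
theorem fromBlocks_sqrt_mul_self {F : Matrix n n 𝕜} (hF : IsUnit F.det) :
    fromBlocks 0 F F⁻¹ 0 * fromBlocks 0 F F⁻¹ 0 = (1 : Matrix (n ⊕ n) (n ⊕ n) 𝕜) := by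
  rw [Matrix.fromBlocks_multiply]
  simp [Matrix.mul_nonsing_inv _ hF, Matrix.nonsing_inv_mul _ hF]

/-- … `[0 A; I 0] = J · diag(F, F)` for `J = [0 F; F⁻¹ 0]`, `F² = A` …
[cite: GolubVanLoan2013, §9.4.2 (9.4.10)] -/
theorem fromBlocks_zero_eq_sqrt_mul {A F : Matrix n n 𝕜} (hFA : F * F = A)
    (hF : IsUnit F.det) : fromBlocks 0 A 1 0 = fromBlocks 0 F F⁻¹ 0 * fromBlocks F 0 0 F := by
  rw [Matrix.fromBlocks_multiply]
  simp [hFA, Matrix.nonsing_inv_mul _ hF]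

/-- … and the two factors commute, `J · diag(F, F) = diag(F, F) · J`.
[cite: GolubVanLoan2013, §9.4.2 (9.4.10)] -/
theorem fromBlocks_sqrt_commute (F : Matrix n n 𝕜) :
    Commute (fromBlocks 0 F F⁻¹ 0) (fromBlocks F 0 0 F) := by
  have hc : F⁻¹ * F = F * F⁻¹ := (commute_inv_right (Commute.refl F)).symm.eq
  show _ * _ = _ * _
  rw [Matrix.fromBlocks_multiply, Matrix.fromBlocks_multiply]
  simp [hc]

/-- **(9.4.7) is (9.4.1) in disguise** ("by making the substitution `X_k = A^{1/2} S_k`"): for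
a nonsingular square root `F` of `A`, `F⁻¹ X₀ = F` … [cite: GolubVanLoan2013, §9.4.2 (9.4.7)] -/
theorem inv_sqrt_mul_newtonSqrt_zero {A F : Matrix n n 𝕜} {X : ℕ → Matrix n n 𝕜}
    (hFA : F * F = A) (hF : IsUnit F.det) (hX0 : X 0 = A) : F⁻¹ * X 0 = F := by
  rw [hX0, ← hFA, ← Matrix.mul_assoc, Matrix.nonsing_inv_mul _ hF, Matrix.one_mul]

/-- … `F` commutes with every iterate `X_k` of (9.4.7) …
[cite: GolubVanLoan2013, §9.4.2 (9.4.7)] -/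
theorem commute_sqrt_newtonSqrt {A F : Matrix n n 𝕜} {X : ℕ → Matrix n n 𝕜} (hFA : F * F = A)
    (hX0 : X 0 = A) (hX : ∀ k, X (k + 1) = (2 : 𝕜)⁻¹ • (X k + (X k)⁻¹ * A)) (k : ℕ) :
    Commute F (X k) := by
  induction k with
  | zero => rw [hX0, ← hFA]; exact (Commute.refl F).mul_right (Commute.refl F)
  | succ k ih =>
    rw [hX]
    refine (ih.add_right ((commute_inv_right ih).mul_right ?_)).smul_right _
    rw [← hFA]; exact (Commute.refl F).mul_right (Commute.refl F)

/-- … and `S_k = F⁻¹ X_k` obeys the Newton sign recursion `S_{k+1} = ½ (S_k + S_k⁻¹)` (9.4.1)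
(with limit candidate `T = I`). [cite: GolubVanLoan2013, §9.4.2 (9.4.7)] -/
theorem inv_sqrt_mul_newtonSqrt_succ {A F : Matrix n n 𝕜} {X : ℕ → Matrix n n 𝕜}
    (hFA : F * F = A) (hF : IsUnit F.det) (hX0 : X 0 = A)
    (hX : ∀ k, X (k + 1) = (2 : 𝕜)⁻¹ • (X k + (X k)⁻¹ * A)) (k : ℕ) :
    F⁻¹ * X (k + 1) = (2 : 𝕜)⁻¹ • (F⁻¹ * X k + (F⁻¹ * X k)⁻¹) := by
  have hc : Commute (X k)⁻¹ F⁻¹ :=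
    commute_inv_right (commute_inv_right (commute_sqrt_newtonSqrt hFA hX0 hX k)).symm
  rw [hX, Matrix.mul_smul, Matrix.mul_add, Matrix.mul_inv_rev, Matrix.nonsing_inv_nonsing_inv _ hF,
    ← hFA, ← Matrix.mul_assoc F⁻¹, ← hc.eq, Matrix.mul_assoc, ← Matrix.mul_assoc F⁻¹,
    Matrix.nonsing_inv_mul _ hF, Matrix.one_mul]

/-! ## Part I(b) — (9.4.2)–(9.4.4) and the Cayley parametrisation (characteristic `0`) -/

variable [CharZero 𝕜]

/-- **(9.4.2)**: `S_{k+1} − S = ½ S_k⁻¹ (S_k − S)²` for `S_{k+1} = ½ (S_k + S_k⁻¹)` and any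
involution `S = T` commuting with the nonsingular `S_k`.
[cite: GolubVanLoan2013, §9.4.1 (9.4.2)] -/
theorem newtonStep_sub_invol {S T : Matrix n n 𝕜} (hT : T * T = 1) (hc : Commute S T)
    (hS : IsUnit S.det) :
    (2 : 𝕜)⁻¹ • (S + S⁻¹) - T = (2 : 𝕜)⁻¹ • (S⁻¹ * (S - T) ^ 2) := by
  rw [inv_mul_sub_sq hT hc hS, smul_sub, inv_smul_smul₀ two_ne_zero]

/-- **(9.4.3)**: `S_{k+1} + S = ½ S_k⁻¹ (S_k + S)²`. [cite: GolubVanLoan2013, §9.4.1 (9.4.3)] -/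
theorem newtonStep_add_invol {S T : Matrix n n 𝕜} (hT : T * T = 1) (hc : Commute S T)
    (hS : IsUnit S.det) :
    (2 : 𝕜)⁻¹ • (S + S⁻¹) + T = (2 : 𝕜)⁻¹ • (S⁻¹ * (S + T) ^ 2) := by
  rw [inv_mul_add_sq hT hc hS, smul_add (2 : 𝕜)⁻¹ (S + S⁻¹), inv_smul_smul₀ two_ne_zero]

/-- `S_{k+1} + S` has the right inverse `2 (S_k + S)⁻² S_k` when `S_k` and `S_k + S` are
nonsingular (the book argues through the eigenvalues `λ + sign λ ≠ 0`).
[cite: GolubVanLoan2013, §9.4.1 (9.4.3)–(9.4.4)] -/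
theorem newtonStep_add_invol_mul {S T : Matrix n n 𝕜} (hT : T * T = 1) (hc : Commute S T)
    (hS : IsUnit S.det) (hST : IsUnit (S + T).det) :
    ((2 : 𝕜)⁻¹ • (S + S⁻¹) + T) * ((2 : 𝕜) • ((S + T)⁻¹ * (S + T)⁻¹ * S)) = 1 := by
  rw [newtonStep_add_invol hT hc hS, smul_mul_smul_comm, inv_mul_cancel₀ two_ne_zero, one_smul,
    sq]
  calc S⁻¹ * ((S + T) * (S + T)) * ((S + T)⁻¹ * (S + T)⁻¹ * S)
        = S⁻¹ * ((S + T) * ((S + T) * (S + T)⁻¹) * (S + T)⁻¹) * S := by noncomm_ring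
    _ = 1 := by
        rw [Matrix.mul_nonsing_inv _ hST, Matrix.mul_one, Matrix.mul_nonsing_inv _ hST,
          Matrix.mul_one, Matrix.nonsing_inv_mul _ hS]

/-- Hence `S_{k+1} + S` is nonsingular. [cite: GolubVanLoan2013, §9.4.1 (9.4.3)–(9.4.4)] -/
theorem isUnit_det_newtonStep_add {S T : Matrix n n 𝕜} (hT : T * T = 1) (hc : Commute S T)
    (hS : IsUnit S.det) (hST : IsUnit (S + T).det) :
    IsUnit ((2 : 𝕜)⁻¹ • (S + S⁻¹) + T).det :=
  Matrix.isUnit_det_of_right_inverse (newtonStep_add_invol_mul hT hc hS hST)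

/-- **(9.4.4)**: "by manipulating (9.4.2) and (9.4.3)", `G_{k+1} = G_k²` for
`G_k = (S_k − S)(S_k + S)⁻¹`. [cite: GolubVanLoan2013, §9.4.1 (9.4.4)] -/
theorem cayley_newtonStep {S T : Matrix n n 𝕜} (hT : T * T = 1) (hc : Commute S T)
    (hS : IsUnit S.det) (hST : IsUnit (S + T).det) :
    ((2 : 𝕜)⁻¹ • (S + S⁻¹) - T) * ((2 : 𝕜)⁻¹ • (S + S⁻¹) + T)⁻¹ =
      ((S - T) * (S + T)⁻¹) ^ 2 := by
  rw [Matrix.inv_eq_right_inv (newtonStep_add_invol_mul hT hc hS hST),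
    newtonStep_sub_invol hT hc hS, smul_mul_smul_comm, inv_mul_cancel₀ two_ne_zero, one_smul]
  have h1 : Commute (S - T) (S + T)⁻¹ :=
    commute_inv_right (((Commute.refl S).sub_left hc.symm).add_right
      (hc.sub_left (Commute.refl T)))
  have h2 : Commute S (S + T)⁻¹ := commute_inv_right ((Commute.refl S).add_right hc)
  have h3 : Commute S (S - T) := (Commute.refl S).sub_right hc
  have h4 : Commute S ((S - T) ^ 2 * (S + T)⁻¹ ^ 2) :=
    (h3.pow_right 2).mul_right (h2.pow_right 2)
  calc S⁻¹ * (S - T) ^ 2 * ((S + T)⁻¹ * (S + T)⁻¹ * S)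
        = S⁻¹ * ((S - T) ^ 2 * (S + T)⁻¹ ^ 2 * S) := by rw [sq (S + T)⁻¹]; noncomm_ring
    _ = S⁻¹ * S * ((S - T) ^ 2 * (S + T)⁻¹ ^ 2) := by rw [← h4.eq]; noncomm_ring
    _ = ((S - T) * (S + T)⁻¹) ^ 2 := by rw [Matrix.nonsing_inv_mul _ hS, Matrix.one_mul, h1.mul_pow]

/-- `(I − G)⁻¹ = ½ (S + T) T` for the Cayley transform `G = (S − T)(S + T)⁻¹` of any `S`
commuting with the involution `T`, `S + T` nonsingular. [cite: GolubVanLoan2013, §9.4.1 (9.4.4)] -/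
theorem one_sub_cayley_mul {S T : Matrix n n 𝕜} (hT : T * T = 1) (hST : IsUnit (S + T).det) :
    (1 - (S - T) * (S + T)⁻¹) * ((2 : 𝕜)⁻¹ • ((S + T) * T)) = 1 := by
  rw [one_sub_cayley hST, smul_mul_smul_comm, mul_inv_cancel₀ two_ne_zero, one_smul,
    Matrix.mul_assoc, ← Matrix.mul_assoc (S + T)⁻¹, Matrix.nonsing_inv_mul _ hST, Matrix.one_mul,
    hT]

/-- Hence `I − G` is nonsingular … [cite: GolubVanLoan2013, §9.4.1 (9.4.4)] -/
theorem isUnit_det_one_sub_cayley {S T : Matrix n n 𝕜} (hT : T * T = 1)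
    (hST : IsUnit (S + T).det) : IsUnit (1 - (S - T) * (S + T)⁻¹).det :=
  Matrix.isUnit_det_of_right_inverse (one_sub_cayley_mul hT hST)

/-- … with `(I − G)⁻¹ = ½ (S + T) T`. [cite: GolubVanLoan2013, §9.4.1 (9.4.4)] -/
theorem inv_one_sub_cayley {S T : Matrix n n 𝕜} (hT : T * T = 1) (hST : IsUnit (S + T).det) :
    (1 - (S - T) * (S + T)⁻¹)⁻¹ = (2 : 𝕜)⁻¹ • ((S + T) * T) :=
  Matrix.inv_eq_right_inv (one_sub_cayley_mul hT hST)

/-- **The Cayley parametrisation** "`S_k = S (I + G_k)(I − G_k)⁻¹`": every `S` commuting with the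
involution `T` with `S + T` nonsingular equals `T (I + G)(I − G)⁻¹`, `G = (S − T)(S + T)⁻¹`.
[cite: GolubVanLoan2013, §9.4.1 (9.4.4)] -/
theorem eq_invol_mul_cayley {S T : Matrix n n 𝕜} (hT : T * T = 1) (hc : Commute S T)
    (hST : IsUnit (S + T).det) :
    S = T * (1 + (S - T) * (S + T)⁻¹) * (1 - (S - T) * (S + T)⁻¹)⁻¹ := by
  rw [one_add_cayley hST, inv_one_sub_cayley hT hST, Matrix.mul_smul, Matrix.mul_smul,
    smul_mul_assoc, smul_smul, inv_mul_cancel₀ two_ne_zero, one_smul]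
  calc S = S * (T * T) := by rw [hT, Matrix.mul_one]
    _ = T * S * ((S + T)⁻¹ * (S + T)) * T := by
        rw [Matrix.nonsing_inv_mul _ hST, Matrix.mul_one, ← hc.eq, Matrix.mul_assoc]
    _ = T * (S * (S + T)⁻¹) * ((S + T) * T) := by noncomm_ring

/-- Hence `S − T = 2 T G (I − G)⁻¹` — the form in which `G_k → O` forces `S_k → S`.
[cite: GolubVanLoan2013, §9.4.1 (9.4.4)] -/
theorem sub_invol_eq_cayley {S T : Matrix n n 𝕜} (hT : T * T = 1) (hc : Commute S T)
    (hST : IsUnit (S + T).det) :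
    S - T = (2 : 𝕜) • (T * ((S - T) * (S + T)⁻¹) * (1 - (S - T) * (S + T)⁻¹)⁻¹) := by
  have hu := isUnit_det_one_sub_cayley hT hST
  have e := eq_invol_mul_cayley hT hc hST
  calc S - T = T * (1 + (S - T) * (S + T)⁻¹) * (1 - (S - T) * (S + T)⁻¹)⁻¹
        - T * (1 - (S - T) * (S + T)⁻¹) * (1 - (S - T) * (S + T)⁻¹)⁻¹ := by
        rw [Matrix.mul_nonsing_inv_cancel_right _ T hu, ← e]
    _ = (2 : 𝕜) • (T * ((S - T) * (S + T)⁻¹) * (1 - (S - T) * (S + T)⁻¹)⁻¹) := by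
        rw [← sub_mul, ← Matrix.mul_sub, add_sub_sub_cancel, ← two_smul 𝕜, Matrix.mul_smul,
          smul_mul_assoc]

/-- In the Cayley parametrisation, `S` is nonsingular iff `I + G` is (`T` and `I − G` being
nonsingular). [cite: GolubVanLoan2013, §9.4.1 (9.4.4)] -/
theorem isUnit_det_iff_one_add_cayley {S T : Matrix n n 𝕜} (hT : T * T = 1) (hc : Commute S T)
    (hST : IsUnit (S + T).det) :
    IsUnit S.det ↔ IsUnit (1 + (S - T) * (S + T)⁻¹).det := by
  have hd : S.det = T.det * (1 + (S - T) * (S + T)⁻¹).det *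
      ((1 - (S - T) * (S + T)⁻¹)⁻¹).det := by
    conv_lhs => rw [eq_invol_mul_cayley hT hc hST]
    rw [Matrix.det_mul, Matrix.det_mul]
  rw [hd, IsUnit.mul_iff, IsUnit.mul_iff]
  exact ⟨fun h => h.1.2, fun h => ⟨⟨Matrix.isUnit_det_of_right_inverse hT, h⟩,
    Matrix.isUnit_nonsing_inv_det _ (isUnit_det_one_sub_cayley hT hST)⟩⟩

/-- **Along (9.4.1)** (assumed well defined, i.e. every `S_k` nonsingular): `S` commutes with
`S_k`, `S_k + S` is nonsingular, and "it follows by induction that `G_k = G₀^{2^k}`".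
[cite: GolubVanLoan2013, §9.4.1 (9.4.4)] -/
theorem newtonSeq_invariant {S : ℕ → Matrix n n 𝕜} {T : Matrix n n 𝕜} (hT : T * T = 1)
    (hc : Commute (S 0) T) (h0 : IsUnit (S 0 + T).det) (hu : ∀ k, IsUnit (S k).det)
    (hS : ∀ k, S (k + 1) = (2 : 𝕜)⁻¹ • (S k + (S k)⁻¹)) (k : ℕ) :
    Commute (S k) T ∧ IsUnit (S k + T).det ∧
      (S k - T) * (S k + T)⁻¹ = ((S 0 - T) * (S 0 + T)⁻¹) ^ 2 ^ k := by
  induction k with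
  | zero => exact ⟨hc, h0, by rw [pow_zero, pow_one]⟩
  | succ k ih =>
    obtain ⟨hck, hTk, hGk⟩ := ih
    refine ⟨?_, ?_, ?_⟩
    · rw [hS]; exact commute_newtonStep hck
    · rw [hS]; exact isUnit_det_newtonStep_add hT hck (hu k) hTk
    · rw [hS, cayley_newtonStep hT hck (hu k) hTk, hGk, ← pow_mul, pow_succ]

/-- `G_k = G₀^{2^k}` along (9.4.1). [cite: GolubVanLoan2013, §9.4.1 (9.4.4)] -/
theorem cayley_newtonSeq {S : ℕ → Matrix n n 𝕜} {T : Matrix n n 𝕜} (hT : T * T = 1)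
    (hc : Commute (S 0) T) (h0 : IsUnit (S 0 + T).det) (hu : ∀ k, IsUnit (S k).det)
    (hS : ∀ k, S (k + 1) = (2 : 𝕜)⁻¹ • (S k + (S k)⁻¹)) (k : ℕ) :
    (S k - T) * (S k + T)⁻¹ = ((S 0 - T) * (S 0 + T)⁻¹) ^ 2 ^ k :=
  (newtonSeq_invariant hT hc h0 hu hS k).2.2

/-- `S_k = S (I + G₀^{2^k})(I − G₀^{2^k})⁻¹` along (9.4.1) ("`S_k = S(I + G_k)(I − G_k)⁻¹`").
[cite: GolubVanLoan2013, §9.4.1 (9.4.4)] -/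
theorem newtonSeq_eq_cayley {S : ℕ → Matrix n n 𝕜} {T : Matrix n n 𝕜} (hT : T * T = 1)
    (hc : Commute (S 0) T) (h0 : IsUnit (S 0 + T).det) (hu : ∀ k, IsUnit (S k).det)
    (hS : ∀ k, S (k + 1) = (2 : 𝕜)⁻¹ • (S k + (S k)⁻¹)) (k : ℕ) :
    S k = T * (1 + ((S 0 - T) * (S 0 + T)⁻¹) ^ 2 ^ k) *
      (1 - ((S 0 - T) * (S 0 + T)⁻¹) ^ 2 ^ k)⁻¹ := by
  obtain ⟨hck, hTk, hGk⟩ := newtonSeq_invariant hT hc h0 hu hS k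
  rw [← hGk]
  exact eq_invol_mul_cayley hT hck hTk

/-- The error representation `S_k − S = 2 S G₀^{2^k} (I − G₀^{2^k})⁻¹` along (9.4.1).
[cite: GolubVanLoan2013, §9.4.1 (9.4.4)] -/
theorem newtonSeq_sub_eq_cayley {S : ℕ → Matrix n n 𝕜} {T : Matrix n n 𝕜} (hT : T * T = 1)
    (hc : Commute (S 0) T) (h0 : IsUnit (S 0 + T).det) (hu : ∀ k, IsUnit (S k).det)
    (hS : ∀ k, S (k + 1) = (2 : 𝕜)⁻¹ • (S k + (S k)⁻¹)) (k : ℕ) :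
    S k - T = (2 : 𝕜) • (T * ((S 0 - T) * (S 0 + T)⁻¹) ^ 2 ^ k *
      (1 - ((S 0 - T) * (S 0 + T)⁻¹) ^ 2 ^ k)⁻¹) := by
  obtain ⟨hck, hTk, hGk⟩ := newtonSeq_invariant hT hc h0 hu hS k
  rw [← hGk]
  exact sub_invol_eq_cayley hT hck hTk

/-! ## Part II — the Newton–Schulz residual law -/

/-- The residual law of the Newton–Schulz iteration (9.4.5): with `S_{k+1} = ½ S_k (3I − S_k²)`,
`I − S_{k+1}² = ¼ (I − S_k²)² (4I − S_k²)` — so `I − S_k² → O` quadratically once it is small.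
[cite: GolubVanLoan2013, §9.4.1 (9.4.5)] -/
theorem one_sub_newtonSchulzStep_sq (S : Matrix n n 𝕜) :
    1 - ((2 : 𝕜)⁻¹ • (S * (3 - S ^ 2))) ^ 2 = (4 : 𝕜)⁻¹ • ((1 - S ^ 2) ^ 2 * (4 - S ^ 2)) := by
  have hc : Commute S (3 - S ^ 2) := (Commute.ofNat_right S 3).sub_right (Commute.self_pow S 2)
  have h4 : ((2 : 𝕜)⁻¹) ^ 2 = (4 : 𝕜)⁻¹ := by norm_num
  have h4m : (4 : 𝕜)⁻¹ • (4 : Matrix n n 𝕜) = 1 := by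
    rw [← map_ofNat (algebraMap 𝕜 (Matrix n n 𝕜)) 4, Algebra.algebraMap_eq_smul_one,
      inv_smul_smul₀ (by norm_num : (4 : 𝕜) ≠ 0)]
  have hP : S ^ 2 * (3 - S ^ 2) ^ 2 = 4 - (1 - S ^ 2) ^ 2 * (4 - S ^ 2) := by
    rw [show (3 : Matrix n n 𝕜) = 3 • 1 from (nsmul_one 3).symm,
      show (4 : Matrix n n 𝕜) = 4 • 1 from (nsmul_one 4).symm]
    noncomm_ring
  rw [smul_pow, hc.mul_pow, h4, hP, smul_sub, h4m, sub_sub_cancel]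

/-- The same law in terms of the residual `E_k = I − S_k²`: `E_{k+1} = ¼ E_k² (3I + E_k)`.
[cite: GolubVanLoan2013, §9.4.1 (9.4.5)] -/
theorem one_sub_newtonSchulzStep_sq' (S : Matrix n n 𝕜) :
    1 - ((2 : 𝕜)⁻¹ • (S * (3 - S ^ 2))) ^ 2 =
      (4 : 𝕜)⁻¹ • ((1 - S ^ 2) ^ 2 * (3 + (1 - S ^ 2))) := by
  rw [one_sub_newtonSchulzStep_sq]
  congr 2
  rw [show (4 : Matrix n n 𝕜) = 3 + 1 by norm_num]
  abel

end Field

/-! ## Part IV — the Newton iteration (9.4.11) for the polar factor -/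

section Polar

variable {𝕜 : Type*} [Field 𝕜] [StarRing 𝕜] {n : Type*} [Fintype n] [DecidableEq n]

/-- For `X = U P` with `Uᴴ U = I` and `P` Hermitian nonsingular, `X⁻ᴴ = U P⁻¹` (the computation
in (9.4.12)). [cite: GolubVanLoan2013, §9.4.3 (9.4.12)] -/
theorem conjTranspose_inv_of_polar {U P X : Matrix n n 𝕜} (hU : Uᴴ * U = 1) (hP : Pᴴ = P)
    (hPu : IsUnit P.det) (hX : X = U * P) : Xᴴ⁻¹ = U * P⁻¹ := by
  apply Matrix.inv_eq_right_inv
  rw [hX, Matrix.conjTranspose_mul, hP, Matrix.mul_assoc, ← Matrix.mul_assoc Uᴴ, hU,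
    Matrix.one_mul, Matrix.mul_nonsing_inv _ hPu]

/-- **(9.4.12)**: `½ (X + X⁻ᴴ) = U · ½ (P + P⁻¹)` for `X = U P` as above — one step of (9.4.11) is
one Newton sign step (9.4.1) on the Hermitian factor. [cite: GolubVanLoan2013, §9.4.3 (9.4.12)] -/
theorem polarNewtonStep_eq {U P X : Matrix n n 𝕜} (hU : Uᴴ * U = 1) (hP : Pᴴ = P)
    (hPu : IsUnit P.det) (hX : X = U * P) :
    (2 : 𝕜)⁻¹ • (X + Xᴴ⁻¹) = U * ((2 : 𝕜)⁻¹ • (P + P⁻¹)) := by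
  rw [conjTranspose_inv_of_polar hU hP hPu hX, hX, Matrix.mul_smul, Matrix.mul_add]

/-- The Newton sign step preserves Hermitian matrices. [cite: GolubVanLoan2013, §9.4.3 (9.4.12)] -/
theorem conjTranspose_newtonStep {P : Matrix n n 𝕜} (hP : Pᴴ = P) :
    ((2 : 𝕜)⁻¹ • (P + P⁻¹))ᴴ = (2 : 𝕜)⁻¹ • (P + P⁻¹) := by
  rw [Matrix.conjTranspose_smul, Matrix.conjTranspose_add, Matrix.conjTranspose_nonsing_inv, hP,
    star_inv₀, star_ofNat]

/-- **Along (9.4.11)** started at `X₀ = U P` (`Uᴴ U = I`, `P` Hermitian, all `P_k` nonsingular):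
`X_k = U P_k`, where `P_{k+1} = ½ (P_k + P_k⁻¹)`, `P₀ = P` is the Newton sign iteration (9.4.1),
and every `P_k` is Hermitian. [cite: GolubVanLoan2013, §9.4.3 (9.4.11)–(9.4.12)] -/
theorem polarNewton_eq_mul {U P : Matrix n n 𝕜} {X Q : ℕ → Matrix n n 𝕜} (hU : Uᴴ * U = 1)
    (hP : Pᴴ = P) (hX0 : X 0 = U * P) (hX : ∀ k, X (k + 1) = (2 : 𝕜)⁻¹ • (X k + (X k)ᴴ⁻¹))
    (hQ0 : Q 0 = P) (hQ : ∀ k, Q (k + 1) = (2 : 𝕜)⁻¹ • (Q k + (Q k)⁻¹))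
    (hQu : ∀ k, IsUnit (Q k).det) (k : ℕ) : (Q k)ᴴ = Q k ∧ X k = U * Q k := by
  induction k with
  | zero => rw [hQ0, hX0]; exact ⟨hP, rfl⟩
  | succ k ih =>
    obtain ⟨hQk, hXk⟩ := ih
    refine ⟨?_, ?_⟩
    · rw [hQ]; exact conjTranspose_newtonStep hQk
    · rw [hX, hQ]; exact polarNewtonStep_eq hU hQk (hQu k) hXk

/-- Hence `X_k − U = U (P_k − I)`, so that `‖X_k − U‖ = ‖P_k − I‖` in any unitarily invariant
norm and `X_k → U` exactly when `P_k → sign(P) = I`.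
[cite: GolubVanLoan2013, §9.4.3 (9.4.12)] -/
theorem polarNewton_sub_eq {U P : Matrix n n 𝕜} {X Q : ℕ → Matrix n n 𝕜} (hU : Uᴴ * U = 1)
    (hP : Pᴴ = P) (hX0 : X 0 = U * P) (hX : ∀ k, X (k + 1) = (2 : 𝕜)⁻¹ • (X k + (X k)ᴴ⁻¹))
    (hQ0 : Q 0 = P) (hQ : ∀ k, Q (k + 1) = (2 : 𝕜)⁻¹ • (Q k + (Q k)⁻¹))
    (hQu : ∀ k, IsUnit (Q k).det) (k : ℕ) : X k - U = U * (Q k - 1) := by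
  rw [(polarNewton_eq_mul hU hP hX0 hX hQ0 hQ hQu k).2, Matrix.mul_sub, Matrix.mul_one]

end Polar

/-! ## Part V — convergence -/

section Convergence

open Literature.LinearAlgebra.Matrix.HyperpowerIteration

variable {𝕜 : Type*} [RCLike 𝕜] {n : Type*} [Fintype n] [DecidableEq n]

/-- If `G` is a convergent matrix (`G^j → O`) then `I + G^m` is nonsingular for `m ≥ 1`
(its eigenvalues are `1 + μ^m`, `|μ| < 1`; here: `I − G^{2m} = (I + G^m)(I − G^m)` is).
[folklore] -/
private theorem isUnit_det_one_add_pow {G : Matrix n n 𝕜}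
    (hG : Tendsto (fun j : ℕ => G ^ j) atTop (𝓝 0)) {m : ℕ} (hm : 0 < m) :
    IsUnit (1 + G ^ m).det := by
  have hsub : Tendsto (fun k : ℕ => 2 * m * k) atTop atTop :=
    tendsto_atTop_mono (fun k => Nat.le_mul_of_pos_left k (by omega)) tendsto_id
  have h2 : Tendsto (fun k : ℕ => (G ^ (2 * m)) ^ k) atTop (𝓝 0) := by
    simpa only [← pow_mul, Function.comp_def] using hG.comp hsub
  have hu : IsUnit (1 - G ^ (2 * m)).det :=
    (Matrix.isUnit_iff_isUnit_det _).1 (isUnit_one_sub_of_tendsto_pow h2)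
  have hfac : 1 - G ^ (2 * m) = (1 + G ^ m) * (1 - G ^ m) :=
    calc 1 - G ^ (2 * m) = 1 * 1 - G ^ m * G ^ m := by rw [Matrix.one_mul, two_mul, pow_add]
      _ = (1 + G ^ m) * (1 - G ^ m) := (Commute.one_left _).mul_self_sub_mul_self_eq
  rw [hfac, Matrix.det_mul] at hu
  exact isUnit_of_mul_isUnit_left hu

/-- **Well-definedness and the invariants of (9.4.1) from `G₀^j → O` alone**: if `T² = I`,
`T` commutes with `S₀`, `S₀ + T` is nonsingular and the Cayley transform `G₀ = (S₀ − T)(S₀ + T)⁻¹`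
is a convergent matrix, then every `S_k` is nonsingular (no hypothesis on the eigenvalues of
`S_k` is needed), commutes with `T`, has `S_k + T` nonsingular, and `G_k = G₀^{2^k}`.
[cite: GolubVanLoan2013, §9.4.1 (9.4.1)–(9.4.4)] -/
theorem newtonSeq_invariant_of_tendsto {S : ℕ → Matrix n n 𝕜} {T : Matrix n n 𝕜}
    (hT : T * T = 1) (hc : Commute (S 0) T) (h0 : IsUnit (S 0 + T).det)
    (hG : Tendsto (fun j : ℕ => ((S 0 - T) * (S 0 + T)⁻¹) ^ j) atTop (𝓝 0))
    (hS : ∀ k, S (k + 1) = (2 : 𝕜)⁻¹ • (S k + (S k)⁻¹)) (k : ℕ) :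
    IsUnit (S k).det ∧ Commute (S k) T ∧ IsUnit (S k + T).det ∧
      (S k - T) * (S k + T)⁻¹ = ((S 0 - T) * (S 0 + T)⁻¹) ^ 2 ^ k := by
  induction k with
  | zero =>
    refine ⟨?_, hc, h0, by rw [pow_zero, pow_one]⟩
    rw [isUnit_det_iff_one_add_cayley hT hc h0]
    simpa only [pow_one] using isUnit_det_one_add_pow hG one_pos
  | succ k ih =>
    obtain ⟨huk, hck, hTk, hGk⟩ := ih
    have hc' : Commute (S (k + 1)) T := by rw [hS]; exact commute_newtonStep hck
    have hT' : IsUnit (S (k + 1) + T).det := by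
      rw [hS]; exact isUnit_det_newtonStep_add hT hck huk hTk
    have hG' : (S (k + 1) - T) * (S (k + 1) + T)⁻¹ = ((S 0 - T) * (S 0 + T)⁻¹) ^ 2 ^ (k + 1) := by
      rw [hS, cayley_newtonStep hT hck huk hTk, hGk, ← pow_mul, pow_succ]
    refine ⟨?_, hc', hT', hG'⟩
    rw [isUnit_det_iff_one_add_cayley hT hc' hT', hG']
    exact isUnit_det_one_add_pow hG (by positivity)

/-- Matrix inversion is continuous at `I`. [folklore] -/
private theorem tendsto_inv_one_sub {G : ℕ → Matrix n n 𝕜} (hG : Tendsto G atTop (𝓝 0)) :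
    Tendsto (fun k => (1 - G k)⁻¹) atTop (𝓝 1) := by
  have hc1 : ContinuousAt (Inv.inv : Matrix n n 𝕜 → Matrix n n 𝕜) 1 := by
    refine continuousAt_matrix_inv _ ?_
    rw [Matrix.det_one, Ring.inverse_eq_inv']
    exact continuousAt_inv₀ one_ne_zero
  have h1 : Tendsto (fun k : ℕ => 1 - G k) atTop (𝓝 1) := by
    simpa using (tendsto_const_nhds (x := (1 : Matrix n n 𝕜))).sub hG
  have h2 : Tendsto (fun k => (1 - G k)⁻¹) atTop (𝓝 (1 : Matrix n n 𝕜)⁻¹) :=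
    hc1.tendsto.comp h1
  rwa [inv_one] at h2

/-- **Convergence of the Newton sign iteration (9.4.1)**: under the hypotheses of
`newtonSeq_invariant_of_tendsto` — in particular "`G_k → 0`", here `G₀^j → O` — `S_k → T`
("and so `S_k = S(I + G_k)(I − G_k)⁻¹ → S`").  For `T = sign(A)` the hypothesis holds because the
eigenvalues `μ = (λ − sign λ)/(λ + sign λ)` of `G₀` have `|μ| < 1`
(`Literature.Analysis.Complex.norm_cayley_lt_one`, `norm_cayley_neg_lt_one`).
[cite: GolubVanLoan2013, §9.4.1 (9.4.1)–(9.4.4)] -/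
theorem tendsto_newtonSeq {S : ℕ → Matrix n n 𝕜} {T : Matrix n n 𝕜} (hT : T * T = 1)
    (hc : Commute (S 0) T) (h0 : IsUnit (S 0 + T).det)
    (hG : Tendsto (fun j : ℕ => ((S 0 - T) * (S 0 + T)⁻¹) ^ j) atTop (𝓝 0))
    (hS : ∀ k, S (k + 1) = (2 : 𝕜)⁻¹ • (S k + (S k)⁻¹)) : Tendsto S atTop (𝓝 T) := by
  set G₀ := (S 0 - T) * (S 0 + T)⁻¹ with hG₀
  have hGk : Tendsto (fun k : ℕ => G₀ ^ 2 ^ k) atTop (𝓝 0) := by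
    simpa only [Function.comp_def] using hG.comp (tendsto_pow_atTop_atTop_of_one_lt one_lt_two)
  have hform : ∀ k, S k - T = (2 : 𝕜) • (T * G₀ ^ 2 ^ k * (1 - G₀ ^ 2 ^ k)⁻¹) := fun k => by
    obtain ⟨-, hck, hTk, hGk'⟩ := newtonSeq_invariant_of_tendsto hT hc h0 hG hS k
    rw [← hGk']
    exact sub_invol_eq_cayley hT hck hTk
  have hdiff : Tendsto (fun k => S k - T) atTop (𝓝 0) := by
    have h := (((tendsto_const_nhds (x := T)).mul hGk).mul (tendsto_inv_one_sub hGk)).const_smul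
      (2 : 𝕜)
    rw [Matrix.mul_zero, Matrix.zero_mul, smul_zero] at h
    exact h.congr fun k => (hform k).symm
  simpa using hdiff.add_const T

/-- **Convergence of the Newton square-root iteration (9.4.7)** ("global convergence … follow[s]
from what we know about (9.4.1)"): if `F² = A`, `F` and `F + I` are nonsingular, the Cayley
transform `(F − I)(F + I)⁻¹` is convergent (for the principal square root its eigenvalues are
`(λ−1)/(λ+1)`, `Re λ > 0`), and the iteration is well defined, then `X_k → F`.
[cite: GolubVanLoan2013, §9.4.2 (9.4.7)] -/
theorem tendsto_newtonSqrt {A F : Matrix n n 𝕜} {X : ℕ → Matrix n n 𝕜} (hFA : F * F = A)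
    (hF : IsUnit F.det) (h1 : IsUnit (F + 1).det)
    (hG : Tendsto (fun j : ℕ => ((F - 1) * (F + 1)⁻¹) ^ j) atTop (𝓝 0)) (hX0 : X 0 = A)
    (hX : ∀ k, X (k + 1) = (2 : 𝕜)⁻¹ • (X k + (X k)⁻¹ * A)) : Tendsto X atTop (𝓝 F) := by
  have hS0 : F⁻¹ * X 0 = F := inv_sqrt_mul_newtonSqrt_zero hFA hF hX0
  have hS : Tendsto (fun k => F⁻¹ * X k) atTop (𝓝 1) := by
    refine tendsto_newtonSeq (S := fun k => F⁻¹ * X k) (T := 1) (Matrix.mul_one 1) ?_ ?_ ?_ ?_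
    · exact Commute.one_right _
    · simpa only [hS0] using h1
    · simpa only [hS0] using hG
    · exact inv_sqrt_mul_newtonSqrt_succ hFA hF hX0 hX
  have hXk : ∀ k, F * (F⁻¹ * X k) = X k := fun k => by
    rw [← Matrix.mul_assoc, Matrix.mul_nonsing_inv _ hF, Matrix.one_mul]
  simpa [hXk] using (tendsto_const_nhds (x := F)).mul hS

/-- **Convergence of the Denman–Beavers iteration (9.4.8)** to `(A^{1/2}, A^{−1/2})`, under the same
hypotheses on the square root `F` ("It follows that `X_k → A^{1/2}` and `Y_k → A^{−1/2}`").
[cite: GolubVanLoan2013, §9.4.2 (9.4.8)–(9.4.10)] -/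
theorem tendsto_denmanBeavers {A F : Matrix n n 𝕜} {X Y : ℕ → Matrix n n 𝕜} (hFA : F * F = A)
    (hF : IsUnit F.det) (h1 : IsUnit (F + 1).det)
    (hG : Tendsto (fun j : ℕ => ((F - 1) * (F + 1)⁻¹) ^ j) atTop (𝓝 0)) (hX0 : X 0 = A)
    (hY0 : Y 0 = 1) (hX : ∀ k, X (k + 1) = (2 : 𝕜)⁻¹ • (X k + (Y k)⁻¹))
    (hY : ∀ k, Y (k + 1) = (2 : 𝕜)⁻¹ • (Y k + (X k)⁻¹)) :
    Tendsto X atTop (𝓝 F) ∧ Tendsto Y atTop (𝓝 F⁻¹) := by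
  have hA : IsUnit A.det := by rw [← hFA, Matrix.det_mul]; exact hF.mul hF
  have hinv := denmanBeavers_invariant hA hX0 hY0 hX hY
  have hX' : ∀ k, X (k + 1) = (2 : 𝕜)⁻¹ • (X k + (X k)⁻¹ * A) := fun k => by
    have hcX : Commute A (X k) := by
      rw [(hinv k).1]; exact (Commute.refl A).mul_right (hinv k).2
    rw [denmanBeavers_fst hA hX0 hY0 hX hY k, (commute_inv_right hcX).eq]
  have hXlim : Tendsto X atTop (𝓝 F) := tendsto_newtonSqrt hFA hF h1 hG hX0 hX'
  refine ⟨hXlim, ?_⟩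
  have hYk : ∀ k, A⁻¹ * X k = Y k := fun k => by
    rw [(hinv k).1, ← Matrix.mul_assoc, Matrix.nonsing_inv_mul _ hA, Matrix.one_mul]
  have hAF : A⁻¹ * F = F⁻¹ := by
    rw [← hFA, Matrix.mul_inv_rev, Matrix.mul_assoc, Matrix.nonsing_inv_mul _ hF, Matrix.mul_one]
  have h := (tendsto_const_nhds (x := A⁻¹)).mul hXlim
  rw [hAF] at h
  exact h.congr hYk

/-- **Convergence of the polar Newton iteration (9.4.11)**: for `X₀ = U P` with `Uᴴ U = I`, `P`
Hermitian with `P`, `P + I` nonsingular, `(P − I)(P + I)⁻¹` convergent (for positive definite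
`P` its eigenvalues are `(λ−1)/(λ+1) ∈ (−1, 1)`) and the iteration well defined, `X_k → U`
("we conclude that [the] `X_k` … converge to `U`").
[cite: GolubVanLoan2013, §9.4.3 (9.4.11)–(9.4.12)] -/
theorem tendsto_polarNewton {U P : Matrix n n 𝕜} {X Q : ℕ → Matrix n n 𝕜} (hU : Uᴴ * U = 1)
    (hP : Pᴴ = P) (h1 : IsUnit (P + 1).det)
    (hG : Tendsto (fun j : ℕ => ((P - 1) * (P + 1)⁻¹) ^ j) atTop (𝓝 0)) (hX0 : X 0 = U * P)
    (hX : ∀ k, X (k + 1) = (2 : 𝕜)⁻¹ • (X k + (X k)ᴴ⁻¹)) (hQ0 : Q 0 = P)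
    (hQ : ∀ k, Q (k + 1) = (2 : 𝕜)⁻¹ • (Q k + (Q k)⁻¹)) : Tendsto X atTop (𝓝 U) := by
  have hc0 : Commute (Q 0) 1 := Commute.one_right _
  have h0 : IsUnit (Q 0 + 1).det := by rw [hQ0]; exact h1
  have hG0 : Tendsto (fun j : ℕ => ((Q 0 - 1) * (Q 0 + 1)⁻¹) ^ j) atTop (𝓝 0) := by
    rw [hQ0]; exact hG
  have hQu : ∀ k, IsUnit (Q k).det := fun k =>
    (newtonSeq_invariant_of_tendsto (Matrix.mul_one 1) hc0 h0 hG0 hQ k).1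
  have hQlim : Tendsto Q atTop (𝓝 1) := tendsto_newtonSeq (Matrix.mul_one 1) hc0 h0 hG0 hQ
  have hXk : ∀ k, U * Q k = X k := fun k => ((polarNewton_eq_mul hU hP hX0 hX hQ0 hQ hQu k).2).symm
  simpa using ((tendsto_const_nhds (x := U)).mul hQlim).congr hXk

end Convergence

/-! ## Part V(b) — the scalar facts and the complex case -/

section Complex

open Literature.LinearAlgebra.Matrix.HyperpowerIteration

/-- The real part of the scalar Newton map (the display after (9.4.1)):
`Re ½(z + 1/z) = (a/2)(1 + 1/(a² + b²))` for `z = a + bi`.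
[cite: GolubVanLoan2013, §9.4.1 (9.4.1)] -/
theorem newton_re (z : ℂ) : ((z + z⁻¹) / 2).re = z.re / 2 * (1 + (Complex.normSq z)⁻¹) := by
  rw [Complex.div_ofNat_re, Complex.add_re, Complex.inv_re]
  ring

/-- … and its imaginary part `Im ½(z + 1/z) = (b/2)(1 − 1/(a² + b²))`.
[cite: GolubVanLoan2013, §9.4.1 (9.4.1)] -/
theorem newton_im (z : ℂ) : ((z + z⁻¹) / 2).im = z.im / 2 * (1 - (Complex.normSq z)⁻¹) := by
  rw [Complex.div_ofNat_im, Complex.add_im, Complex.inv_im]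
  ring

/-- Hence the Newton map preserves the open right half-plane ("an eigenvalue cannot jump across
the imaginary axis during the iteration") … [cite: GolubVanLoan2013, §9.4.1 (9.4.1)] -/
theorem newton_re_pos {z : ℂ} (hz : 0 < z.re) : 0 < ((z + z⁻¹) / 2).re := by
  rw [newton_re]
  exact mul_pos (div_pos hz two_pos)
    (add_pos_of_pos_of_nonneg one_pos (inv_nonneg.2 (Complex.normSq_nonneg z)))

/-- … and the open left half-plane. [cite: GolubVanLoan2013, §9.4.1 (9.4.1)] -/
theorem newton_re_neg {z : ℂ} (hz : z.re < 0) : ((z + z⁻¹) / 2).re < 0 := by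
  rw [newton_re]
  exact mul_neg_of_neg_of_pos (div_neg_of_neg_of_pos hz two_pos)
    (add_pos_of_pos_of_nonneg one_pos (inv_nonneg.2 (Complex.normSq_nonneg z)))

/-- `|λ − 1| < |λ + 1|` for `Re λ > 0` … [cite: GolubVanLoan2013, §9.4.1 (9.4.4)] -/
theorem norm_sub_one_lt_norm_add_one {z : ℂ} (hz : 0 < z.re) : ‖z - 1‖ < ‖z + 1‖ := by
  have h : ‖z - 1‖ ^ 2 < ‖z + 1‖ ^ 2 := by
    rw [Complex.sq_norm, Complex.sq_norm, Complex.normSq_apply, Complex.normSq_apply]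
    simp only [Complex.sub_re, Complex.one_re, Complex.sub_im, Complex.one_im, sub_zero,
      Complex.add_re, Complex.add_im, add_zero]
    nlinarith
  exact lt_of_pow_lt_pow_left₀ 2 (norm_nonneg _) h

/-- … and `|λ + 1| < |λ − 1|` for `Re λ < 0`: the eigenvalues `μ = (λ − sign λ)/(λ + sign λ)` of
`G₀` satisfy `|μ| < 1`. [cite: GolubVanLoan2013, §9.4.1 (9.4.4)] -/
theorem norm_add_one_lt_norm_sub_one {z : ℂ} (hz : z.re < 0) : ‖z + 1‖ < ‖z - 1‖ := by
  have h : ‖z + 1‖ ^ 2 < ‖z - 1‖ ^ 2 := by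
    rw [Complex.sq_norm, Complex.sq_norm, Complex.normSq_apply, Complex.normSq_apply]
    simp only [Complex.sub_re, Complex.one_re, Complex.sub_im, Complex.one_im, sub_zero,
      Complex.add_re, Complex.add_im, add_zero]
    nlinarith
  exact lt_of_pow_lt_pow_left₀ 2 (norm_nonneg _) h

/-- "Since `|μ| < 1` …": `|(λ + 1)/(λ − 1)| < 1` for `Re λ < 0` — the eigenvalue
`μ = (λ − sign λ)/(λ + sign λ)` of `G₀` at an eigenvalue `λ` of `A` with `sign λ = −1`; the case
`Re λ > 0` (`|(λ − 1)/(λ + 1)| < 1`) is `Literature.Analysis.Complex.norm_cayley_lt_one`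
(`ConformalRadiusBoundary.lean`). [cite: GolubVanLoan2013, §9.4.1 (9.4.4)] -/
theorem norm_cayley_neg_lt_one {z : ℂ} (hz : z.re < 0) : ‖(z + 1) / (z - 1)‖ < 1 := by
  have hne : z - 1 ≠ 0 := fun h => by
    have := congrArg Complex.re h
    simp only [Complex.sub_re, Complex.one_re, Complex.zero_re] at this
    linarith
  rw [norm_div, div_lt_one (norm_pos_iff.2 hne)]
  exact norm_add_one_lt_norm_sub_one hz

/-- **The Newton sign iteration over `ℂ`, verbatim**: if `T² = I`, `T` commutes with `A = S₀`,
`A + T` is nonsingular and `ρ((A − T)(A + T)⁻¹) < 1` ("it follows from Lemma 7.3.2 that `G_k → 0`"),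
then (9.4.1) is well defined and `S_k → T`. [cite: GolubVanLoan2013, §9.4.1 (9.4.1)–(9.4.4)] -/
theorem tendsto_newtonSeq_of_spectralRadius_lt_one {n : Type*} [Fintype n] [DecidableEq n]
    {S : ℕ → Matrix n n ℂ} {T : Matrix n n ℂ} (hT : T * T = 1) (hc : Commute (S 0) T)
    (h0 : IsUnit (S 0 + T).det) (hρ : spectralRadius ℂ ((S 0 - T) * (S 0 + T)⁻¹) < 1)
    (hS : ∀ k, S (k + 1) = (2 : ℂ)⁻¹ • (S k + (S k)⁻¹)) : Tendsto S atTop (𝓝 T) :=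
  tendsto_newtonSeq hT hc h0 (tendsto_pow_of_spectralRadius_lt_one_matrix hρ) hS

end Complex

end Literature.LinearAlgebra.Matrix.MatrixSignIteration
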